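import Mathlib

/-!
# Periodic-orbit monodromy of a planar incompressible flow is unipotent (solo soloist, blind mode)

Kernel core of the "zero-vorticity dead line" used in the autopsy of the steady two-scale
(SEIL) ansatz for the zeroth law (HOME paper §23.18(6)).  On a streamline of a steady planar
carrier `V` on which the carrier vorticity vanishes, the leading-order short-wave perturbation
vorticity is transported by the TANGENT cocycle of the flow (Cauchy's formula), so the Floquet
growth of the wave amplitude over one period of the closed (or periodic open) streamline is
governed by the monodromy `Φ T` of the variational equation `ż = DV(x t) z` along the orbit.
This file proves the two classical facts that make that monodromy harmless:

* `monodromy_apply_velocity` / `monodromy_fixes_velocity` (any real normed space): along a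
  solution `x` of `ẋ = V x`, the velocity `t ↦ V (x t)` solves the variational equation, hence
  the solution operator `Φ t` of the variational equation transports `V (x 0)` to `V (x t)`;
  on a periodic orbit (`x T = x 0`) the monodromy `Φ T` FIXES the velocity vector `V (x 0)`.
* `det_conserved_of_traceFree` (Liouville, written for the four entries of a `2 × 2`
  fundamental matrix): a trace-free coefficient matrix (`div V = 0`) keeps the determinant
  constant, so the planar monodromy has determinant `1`.
* `unipotent_of_det_one_of_mulVec_eq` + `pow_eq_one_add_smul_of_unipotent` (pure `2 × 2`
  algebra): a real `2 × 2` matrix of determinant `1` fixing a nonzero vector satisfies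
  `(M - 1)² = 0`, hence `M ^ n = 1 + n • (M - 1)`: its powers grow at most LINEARLY — both
  Floquet multipliers equal `1`, no exponential growth (parabolic monodromy).

Assembled (docstring level; the modelling step "WKB vorticity obeys Cauchy's formula on a
zero-vorticity streamline" is fluid mechanics and is not formalised): on such a streamline the
inviscid short-wave cocycle has Floquet exponent `0` for every wave-vector tilt, so the viscously
damped cocycle is strictly decaying and no neutral lamination can be tuned there
(numerically: `K ≡ 0.000` on the line, `≈ 0.43 |F|` nearby; HOME work/seil/channel).
No fluid-mechanical input is used below beyond the displayed ODEs.
-/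

namespace Summit.AnomalousDissipation.AnomalousDissipation.Theorems

open Set

section General

variable {E : Type*} [NormedAddCommGroup E] [NormedSpace ℝ E]

/-- Along a solution `x` of the autonomous ODE `ẋ = V x`, the velocity `t ↦ V (x t)` solves the
variational (linearised) equation `ż = DV(x t) z`. -/
theorem velocity_hasDerivAt_linearised {V : E → E} {V' : E → (E →L[ℝ] E)} {x : ℝ → E}
    (hV : ∀ t, HasFDerivAt V (V' (x t)) (x t)) (hx : ∀ t, HasDerivAt x (V (x t)) t) (t : ℝ) :
    HasDerivAt (fun s => V (x s)) (V' (x t) (V (x t))) t :=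
  (hV t).comp_hasDerivAt t (hx t)

/-- Uniqueness for a linear ODE `ż = A t z` with uniformly bounded coefficients: two global
solutions with the same value at time `0` coincide. -/
theorem linearised_unique {A : ℝ → (E →L[ℝ] E)} {K : NNReal} (hK : ∀ t, ‖A t‖₊ ≤ K)
    {Z W : ℝ → E} (hZ : ∀ t, HasDerivAt Z (A t (Z t)) t) (hW : ∀ t, HasDerivAt W (A t (W t)) t)
    (h0 : Z 0 = W 0) : Z = W := by
  have hv : ∀ t, LipschitzOnWith K (fun z : E => A t z) univ := fun t =>
    ((A t).lipschitz.weaken (hK t)).lipschitzOnWith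
  exact ODE_solution_unique_univ (v := fun t z => A t z) (s := fun _ => univ) (t₀ := 0) hv
    (fun t => ⟨hZ t, mem_univ _⟩) (fun t => ⟨hW t, mem_univ _⟩) h0

/-- The solution operator `Φ t` of the variational equation along an orbit of `ẋ = V x`
transports the velocity: `Φ t (V (x 0)) = V (x t)`.  Hypotheses: `V` differentiable along the
orbit with derivative `V' (x t)`, these derivatives uniformly bounded in operator norm (true on a
periodic orbit of a `C¹` field), and `Φ` a solution family of the variational equation with
`Φ 0 = 1`. -/
theorem monodromy_apply_velocity {V : E → E} {V' : E → (E →L[ℝ] E)} {x : ℝ → E}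
    (hV : ∀ t, HasFDerivAt V (V' (x t)) (x t)) (hx : ∀ t, HasDerivAt x (V (x t)) t)
    {K : NNReal} (hK : ∀ t, ‖V' (x t)‖₊ ≤ K)
    {Φ : ℝ → (E →L[ℝ] E)} (hΦ : ∀ z t, HasDerivAt (fun s => Φ s z) (V' (x t) (Φ t z)) t)
    (hΦ0 : Φ 0 = 1) (t : ℝ) : Φ t (V (x 0)) = V (x t) := by
  have h := linearised_unique (A := fun s => V' (x s)) hK (Z := fun s => Φ s (V (x 0)))
    (W := fun s => V (x s)) (hΦ (V (x 0))) (velocity_hasDerivAt_linearised hV hx)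
    (by simp [hΦ0])
  exact congrFun h t

/-- On a periodic orbit (`x T = x 0`) the monodromy `Φ T` of the variational equation fixes the
velocity vector `V (x 0)`. -/
theorem monodromy_fixes_velocity {V : E → E} {V' : E → (E →L[ℝ] E)} {x : ℝ → E}
    (hV : ∀ t, HasFDerivAt V (V' (x t)) (x t)) (hx : ∀ t, HasDerivAt x (V (x t)) t)
    {K : NNReal} (hK : ∀ t, ‖V' (x t)‖₊ ≤ K)
    {Φ : ℝ → (E →L[ℝ] E)} (hΦ : ∀ z t, HasDerivAt (fun s => Φ s z) (V' (x t) (Φ t z)) t)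
    (hΦ0 : Φ 0 = 1) {T : ℝ} (hT : x T = x 0) : Φ T (V (x 0)) = V (x 0) := by
  rw [monodromy_apply_velocity hV hx hK hΦ hΦ0 T, hT]

end General

section Planar

/-- LIOUVILLE for a planar linear system, entrywise: if the `2 × 2` fundamental matrix
`[[p, q], [r, s]]` solves `Φ̇ = A(t) Φ` with `A = [[a, b], [c, d]]` trace-free (`a + d = 0`,
i.e. `div V = 0` along the orbit), then `det Φ = p s - q r` is constant. -/
theorem det_conserved_of_traceFree {a b c d p q r s : ℝ → ℝ}
    (hp : ∀ t, HasDerivAt p (a t * p t + b t * r t) t)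
    (hq : ∀ t, HasDerivAt q (a t * q t + b t * s t) t)
    (hr : ∀ t, HasDerivAt r (c t * p t + d t * r t) t)
    (hs : ∀ t, HasDerivAt s (c t * q t + d t * s t) t)
    (htr : ∀ t, a t + d t = 0) (t : ℝ) :
    p t * s t - q t * r t = p 0 * s 0 - q 0 * r 0 := by
  have hD : ∀ τ, HasDerivAt (fun τ => p τ * s τ - q τ * r τ) 0 τ := by
    intro τ
    have h := ((hp τ).mul (hs τ)).sub ((hq τ).mul (hr τ))
    exact h.congr_deriv (by linear_combination (p τ * s τ - q τ * r τ) * htr τ)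
  have hdiff : Differentiable ℝ (fun τ => p τ * s τ - q τ * r τ) := fun τ => (hD τ).differentiableAt
  exact is_const_of_deriv_eq_zero hdiff (fun τ => (hD τ).deriv) t 0

open Matrix

/-- A real `2 × 2` matrix of determinant `1` that fixes a nonzero vector is UNIPOTENT:
`(M - 1)² = 0` (both eigenvalues equal `1`; parabolic or identity). -/
theorem unipotent_of_det_one_of_mulVec_eq (M : Matrix (Fin 2) (Fin 2) ℝ) (v : Fin 2 → ℝ)
    (hdet : M.det = 1) (hv : M *ᵥ v = v) (hv0 : v ≠ 0) :
    (M - 1) * (M - 1) = 0 := by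
  -- `(M - 1) v = 0` with `v ≠ 0` forces `det (M - 1) = 0`
  have hker : (M - 1) *ᵥ v = 0 := by
    rw [Matrix.sub_mulVec, hv, Matrix.one_mulVec, sub_self]
  have hdet0 : (M - 1).det = 0 := (Matrix.exists_mulVec_eq_zero_iff).mp ⟨v, hv0, hker⟩
  rw [Matrix.det_fin_two] at hdet hdet0
  simp only [Matrix.sub_apply, Matrix.one_apply_eq, Matrix.one_apply_ne (by decide : (0 : Fin 2) ≠ 1),
    Matrix.one_apply_ne (by decide : (1 : Fin 2) ≠ 0)] at hdet0
  ext i j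
  fin_cases i <;> fin_cases j <;>
    simp only [Matrix.mul_apply, Fin.sum_univ_two, Matrix.sub_apply, Matrix.one_apply_eq,
      Matrix.one_apply_ne (by decide : (0 : Fin 2) ≠ 1), Matrix.one_apply_ne (by decide : (1 : Fin 2) ≠ 0),
      Matrix.zero_apply, Fin.isValue, Fin.zero_eta, Fin.mk_one, sub_zero]
  · linear_combination (M 0 0 - 1) * hdet - (M 0 0 - 1) * hdet0 - hdet0
  · linear_combination (M 0 1) * hdet - (M 0 1) * hdet0
  · linear_combination (M 1 0) * hdet - (M 1 0) * hdet0
  · linear_combination (M 1 1 - 1) * hdet - (M 1 1 - 1) * hdet0 - hdet0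

/-- Powers of a unipotent matrix grow linearly: `(M - 1)² = 0 ⇒ M ^ n = 1 + n • (M - 1)`.
(So `‖M ^ n‖ = O(n)`: the Floquet/Lyapunov exponent of the monodromy is `0`.) -/
theorem pow_eq_one_add_smul_of_unipotent {R : Type*} [Ring R] (M : R)
    (h : (M - 1) * (M - 1) = 0) (n : ℕ) : M ^ n = 1 + (n : R) * (M - 1) := by
  induction n with
  | zero => simp
  | succ n ih =>
    rw [pow_succ, ih, Nat.cast_succ]
    -- (1 + n N) M = M + n (N M) and N M = N² + N = N, where N = M - 1, N² = 0
    have h2 : (M - 1) * M = M - 1 := by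
      have e : (M - 1) * M = (M - 1) * (M - 1) + (M - 1) := by noncomm_ring
      rw [e, h, zero_add]
    calc (1 + (n : R) * (M - 1)) * M = M + (n : R) * ((M - 1) * M) := by noncomm_ring
      _ = M + (n : R) * (M - 1) := by rw [h2]
      _ = 1 + ((n : R) + 1) * (M - 1) := by noncomm_ring

/-- THE DEAD-LINE LEMMA, planar monodromy form.  Let `M` be the monodromy matrix of the
variational equation over one period of a periodic orbit of a planar divergence-free `C¹`
field: `det M = 1` (Liouville, `det_conserved_of_traceFree`) and `M` fixes the nonzero
velocity vector at the base point (`monodromy_fixes_velocity`).  Then `M` is unipotent and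
`M ^ n = 1 + n • (M - 1)` for all `n`: iterating the period produces at most linear growth,
i.e. Floquet exponent zero. -/
theorem deadLine_monodromy_pow (M : Matrix (Fin 2) (Fin 2) ℝ) (v : Fin 2 → ℝ)
    (hdet : M.det = 1) (hv : M *ᵥ v = v) (hv0 : v ≠ 0) (n : ℕ) :
    M ^ n = 1 + (n : ℝ) • (M - 1) := by
  rw [pow_eq_one_add_smul_of_unipotent M (unipotent_of_det_one_of_mulVec_eq M v hdet hv hv0) n,
    ← nsmul_eq_mul, Nat.cast_smul_eq_nsmul]

/-- Corollary: along the iterated monodromy every vector moves affinely in `n`: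
`M ^ n w = w + n • ((M - 1) w)` — no exponential Floquet growth on a zero-vorticity streamline. -/
theorem deadLine_mulVec_pow (M : Matrix (Fin 2) (Fin 2) ℝ) (v : Fin 2 → ℝ)
    (hdet : M.det = 1) (hv : M *ᵥ v = v) (hv0 : v ≠ 0) (n : ℕ) (w : Fin 2 → ℝ) :
    (M ^ n) *ᵥ w = w + (n : ℝ) • ((M - 1) *ᵥ w) := by
  rw [deadLine_monodromy_pow M v hdet hv hv0 n, Matrix.add_mulVec, Matrix.one_mulVec,
    Matrix.smul_mulVec]

end Planar

end Summit.AnomalousDissipation.AnomalousDissipation.Theorems
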